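import Summits.Schanuel.Schanuel.Theorems.ZilberEacGermDerivation
import HarnessLib

/-!
# The equimodular class, XXXIII: an ALGEBRAIC primitive of `W·S/(q₂D)` (`S² = D`) satisfies the
# trace identity — a minimal relation over `ℂ[z, S]` and its derivative

HONEST FRAMING.  Cell `pub-schanuel` (Zilber's Exponential-Algebraic Closedness, case ladder;
host summit Schanuel), seat 2, gen 24.  The reduction step of the transcendence of the logarithm of a
QUADRATIC algebraic branch (reciprocal-type fibres, the residual of THEOREM EB): let `S, L` be
analytic at `z₀` with `S² = D` near `z₀` and `L' = W S/(q₂ D)` near `z₀` (`q₂, D, W ∈ ℂ[z]`,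
`(q₂D)(z₀) ≠ 0`), and suppose some nonzero `H ∈ ℂ[s][t]` has `H(z, L z) = 0` near `z₀`.  Then
**`exists_trace_identity_of_algebraic`**: there are `a, b, e, f ∈ ℂ[z]` and `M ≥ 1` with
`a + bS ≢ 0` near `z₀` and, near `z₀`,
`(a + bS)·(2q₂D·(e + fS)' + 2WM·S·(a + bS)) - 2q₂D·(a + bS)'·(e + fS) = 0`
(so `((e + fS)/(a + bS))' = -M·L'`, i.e. `L ∈ ℂ(z) + ℂ(z)S` up to a constant — file XXXIV).  Proof:
a relation `P(L) = 0` of minimal degree `M` over the subalgebra `B = ℂ[zGerm, S]` of germs (which is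
stable under the derivation `δ = 2q₂D·d/dz` of file XXXII: `δS = q₂D'S`), differentiated:
`P^δ(L) + 2WS·P'(L) = 0`; the combination `p_M(P^δ + 2WS P') - δ(p_M)P` has degree `< M`, hence
vanishes, and its `t^{M-1}`-coefficient is the identity (every element of `B` is `a(z) + b(z)S`).
[folklore differential algebra, made concrete]; nothing here is specific to Schanuel's conjecture
(neither used nor implied); Mantova–Masser's question (PLMS 2024 §1 p. 5) and EC(3,2) stay OPEN.
-/

noncomputable section

open Filter Topology Polynomial

set_option linter.dupNamespace false

namespace Summit.Schanuel.Schanuel.Theorems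

section Relations

variable {z₀ : ℂ}

/-- From some nonzero polynomial over a ring killing `v` under `aeval`, one of minimal degree.
[folklore] -/
theorem exists_minDegree_aeval {B : Type*} [CommRing B] [Algebra B (AGerm z₀)] (v : AGerm z₀)
    (h : ∃ P : Polynomial B, P ≠ 0 ∧ Polynomial.aeval v P = 0) :
    ∃ P : Polynomial B, P ≠ 0 ∧ Polynomial.aeval v P = 0 ∧
      ∀ Q : Polynomial B, Q ≠ 0 → Polynomial.aeval v Q = 0 → P.natDegree ≤ Q.natDegree := by
  classical
  have hex : ∃ n, ∃ P : Polynomial B, P ≠ 0 ∧ Polynomial.aeval v P = 0 ∧ P.natDegree = n := by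
    obtain ⟨P, hP0, hP⟩ := h; exact ⟨_, P, hP0, hP, rfl⟩
  obtain ⟨P, hP0, hP, hPn⟩ := Nat.find_spec hex
  refine ⟨P, hP0, hP, fun Q hQ0 hQ => ?_⟩
  rw [hPn]
  exact Nat.find_min' hex ⟨Q, hQ0, hQ, rfl⟩

/-- **The trace identity.**  See the module docstring. [folklore differential algebra] (new in
this form) -/
theorem exists_trace_identity_of_algebraic (q₂ D W : ℂ[X]) {S L : ℂ → ℂ}
    (hSan : AnalyticAt ℂ S z₀) (hLan : AnalyticAt ℂ L z₀) (hS2 : ∀ᶠ z in 𝓝 z₀, S z ^ 2 = D.eval z)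
    (hE0 : (q₂ * D).eval z₀ ≠ 0)
    (hL : ∀ᶠ z in 𝓝 z₀, HasDerivAt L (W.eval z * S z / (q₂.eval z * D.eval z)) z)
    {H : ℂ[X][X]} (hH0 : H ≠ 0) (hH : germEval₂ z₀ (AGerm.mk z₀ hLan) H = 0) :
    ∃ (a b e f : ℂ[X]) (M : ℕ), 1 ≤ M ∧
      (¬ (fun z => a.eval z + b.eval z * S z) =ᶠ[𝓝 z₀] 0) ∧
      ∀ᶠ z in 𝓝 z₀,
        (a.eval z + b.eval z * S z) *
            (2 * q₂.eval z * D.eval z * deriv (fun y => e.eval y + f.eval y * S y) z +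
              2 * W.eval z * M * S z * (a.eval z + b.eval z * S z)) -
          2 * q₂.eval z * D.eval z * deriv (fun y => a.eval y + b.eval y * S y) z *
            (e.eval z + f.eval z * S z) = 0 := by
  classical
  -- germs
  set SO := AGerm.mk z₀ hSan with hSO
  set LO := AGerm.mk z₀ hLan with hLO
  set zO := zGerm z₀ with hzO
  have hSO2 : SO ^ 2 = Polynomial.aeval zO D := by
    rw [hzO, aeval_zGerm, hSO, ← AGerm.mk_pow]
    exact (AGerm.mk_eq_mk_iff _ _).2 hS2
  -- `2 S·DS = D'`
  have hDS : 2 * SO * AGerm.D SO = Polynomial.aeval zO (derivative D) := by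
    have h := congrArg AGerm.D hSO2
    rw [AGerm.D_pow, hzO, AGerm.D_aeval_zGerm] at h
    rw [← h]; push_cast; ring
  -- `E·DL = 2W S`, `E = 2 q₂ D`
  set E : AGerm z₀ := Polynomial.aeval zO (C 2 * q₂ * D) with hE
  set σ : AGerm z₀ := Polynomial.aeval zO (C 2 * W) * SO with hσ
  have hEq : ∀ᶠ z in 𝓝 z₀, (q₂ * D).eval z ≠ 0 :=
    (analyticAt_polynomial_eval (q₂ * D) z₀).continuousAt.eventually_ne hE0
  have hDL : E * AGerm.D LO = σ := by
    rw [hE, hσ, hzO, aeval_zGerm, aeval_zGerm, hLO, AGerm.D_mk, hSO, ← AGerm.mk_mul, ← AGerm.mk_mul]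
    refine (AGerm.mk_eq_mk_iff _ _).2 ?_
    filter_upwards [hL, hEq] with z hLz hz
    rw [Polynomial.eval_mul] at hz
    have hq : q₂.eval z ≠ 0 := left_ne_zero_of_mul hz
    have hd : D.eval z ≠ 0 := right_ne_zero_of_mul hz
    simp only [Pi.mul_apply, hLz.deriv, Polynomial.eval_mul, Polynomial.eval_C]
    field_simp
  -- the subalgebra `B = ℂ[zGerm, S]`
  set B : Subalgebra ℂ (AGerm z₀) := Algebra.adjoin ℂ ({zO, SO} : Set (AGerm z₀)) with hB
  have hzB : zO ∈ B := Algebra.subset_adjoin (by simp)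
  have hSB : SO ∈ B := Algebra.subset_adjoin (by simp)
  have haevalB : ∀ r : ℂ[X], Polynomial.aeval zO r ∈ B := fun r =>
    Polynomial.aeval_mem_adjoin_singleton ℂ zO |> fun h =>
      (Algebra.adjoin_mono (by simp : ({zO} : Set (AGerm z₀)) ⊆ {zO, SO})) h
  have hEB : E ∈ B := haevalB _
  have hσB : σ ∈ B := B.mul_mem (haevalB _) hSB
  -- `B` is stable under `δ = E·D`
  have hδB : ∀ x ∈ B, E * AGerm.D x ∈ B := by
    intro x hx
    induction hx using Algebra.adjoin_induction with
    | mem x hx =>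
      rcases hx with rfl | rfl
      · rw [hzO, AGerm.D_zGerm, mul_one]; exact hEB
      · -- `E·DS = 2q₂D·DS = q₂·S·(2S·DS) = q₂ D' S`
        have h : E * AGerm.D SO = Polynomial.aeval zO (q₂ * derivative D) * SO := by
          have e1 : E = Polynomial.aeval zO q₂ * (2 * SO * SO) := by
            rw [hE, map_mul, map_mul, Polynomial.aeval_C, map_ofNat,
              show (2 : AGerm z₀) * SO * SO = 2 * SO ^ 2 by ring, hSO2]
            ring
          rw [e1, map_mul, show Polynomial.aeval zO q₂ * (2 * SO * SO) * AGerm.D SO =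
            Polynomial.aeval zO q₂ * SO * (2 * SO * AGerm.D SO) by ring, hDS]
          ring
        rw [h]
        exact B.mul_mem (haevalB _) hSB
    | algebraMap r => rw [AGerm.D_algebraMap, mul_zero]; exact B.zero_mem
    | add x y hx hy ihx ihy => rw [AGerm.D_add, mul_add]; exact B.add_mem ihx ihy
    | mul x y hx hy ihx ihy =>
      rw [AGerm.D_mul, show E * (x * AGerm.D y + y * AGerm.D x) = x * (E * AGerm.D y) + y * (E * AGerm.D x)
        by ring]
      exact B.add_mem (B.mul_mem hx ihy) (B.mul_mem hy ihx)
  -- every element of `B` is `a(z) + b(z) S`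
  have hrepr : ∀ x ∈ B, ∃ a b : ℂ[X], x = Polynomial.aeval zO a + Polynomial.aeval zO b * SO := by
    intro x hx
    induction hx using Algebra.adjoin_induction with
    | mem x hx =>
      rcases hx with rfl | rfl
      · exact ⟨Polynomial.X, 0, by simp⟩
      · exact ⟨0, 1, by simp⟩
    | algebraMap r => exact ⟨Polynomial.C r, 0, by simp⟩
    | add x y hx hy ihx ihy =>
      obtain ⟨a, b, rfl⟩ := ihx
      obtain ⟨a', b', rfl⟩ := ihy
      exact ⟨a + a', b + b', by simp only [map_add]; ring⟩
    | mul x y hx hy ihx ihy =>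
      obtain ⟨a, b, rfl⟩ := ihx
      obtain ⟨a', b', rfl⟩ := ihy
      refine ⟨a * a' + b * b' * D, a * b' + a' * b, ?_⟩
      have e : SO * SO = Polynomial.aeval zO D := by rw [← pow_two, hSO2]
      simp only [map_add, map_mul]
      linear_combination (Polynomial.aeval zO b * Polynomial.aeval zO b') * e
  -- a relation over `B` for `L`, from `H`
  have hBval : ∀ x : B, algebraMap B (AGerm z₀) x = (x : AGerm z₀) := by intro x; rfl
  set φ : ℂ[X] →ₐ[ℂ] B := Polynomial.aeval (⟨zO, hzB⟩ : B) with hφ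
  have hφval : ∀ r, ((φ r : B) : AGerm z₀) = Polynomial.aeval zO r := fun r => by
    change B.val (φ r) = _
    rw [hφ, ← Polynomial.aeval_algHom_apply B.val]
    rfl
  have hφinj : Function.Injective φ := by
    intro r r' h
    have h' := congrArg (fun x : B => (x : AGerm z₀)) h
    simp only [hφval] at h'
    exact (transcendental_iff_injective.1 (transcendental_zGerm z₀)) h'
  have hrel : ∃ P : Polynomial B, P ≠ 0 ∧ Polynomial.aeval LO P = 0 := by
    refine ⟨H.map φ.toRingHom, ?_, ?_⟩
    · intro h0; rw [Polynomial.map_eq_zero_iff hφinj] at h0; exact hH0 h0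
    · rw [Polynomial.aeval_def, Polynomial.eval₂_map]
      have hcomp : (algebraMap B (AGerm z₀)).comp φ.toRingHom =
          Polynomial.eval₂RingHom (algebraMap ℂ (AGerm z₀)) zO := by
        refine Polynomial.ringHom_ext (fun c => ?_) ?_
        · rw [RingHom.comp_apply, Polynomial.coe_eval₂RingHom, Polynomial.eval₂_C]
          change ((φ (Polynomial.C c) : B) : AGerm z₀) = _
          rw [hφval, Polynomial.aeval_C]
        · rw [RingHom.comp_apply, Polynomial.coe_eval₂RingHom, Polynomial.eval₂_X]
          change ((φ Polynomial.X : B) : AGerm z₀) = _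
          rw [hφval, Polynomial.aeval_X]
      rw [hcomp]
      exact hH
  -- a minimal one
  obtain ⟨P, hP0, hP, hmin⟩ := exists_minDegree_aeval LO hrel
  set M := P.natDegree with hM
  have hpM : P.coeff M ≠ 0 := Polynomial.leadingCoeff_ne_zero.2 hP0
  have hM1 : 1 ≤ M := by
    by_contra hlt
    have hM0 : M = 0 := by omega
    have hPC : P = Polynomial.C (P.coeff 0) := Polynomial.eq_C_of_natDegree_eq_zero hM0
    rw [hPC, Polynomial.aeval_C, hBval] at hP
    have h00 : P.coeff 0 = 0 := by exact_mod_cast hP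
    rw [hM0] at hpM
    exact hpM h00
  -- the derivation on `B` and the differentiated relation
  set δ : B → B := fun x => ⟨E * AGerm.D (x : AGerm z₀), hδB x x.2⟩ with hδ
  have hδval : ∀ x : B, ((δ x : B) : AGerm z₀) = E * AGerm.D (x : AGerm z₀) := fun x => rfl
  set σB : B := ⟨σ, hσB⟩ with hσB'
  set Pδ : Polynomial B := ∑ j ∈ Finset.range (M + 1), Polynomial.monomial j (δ (P.coeff j)) with hPδ
  have hcoefPδ : ∀ j, Pδ.coeff j = if j < M + 1 then δ (P.coeff j) else 0 := by
    intro j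
    rw [hPδ, Polynomial.finsetSum_coeff]
    simp only [Polynomial.coeff_monomial, Finset.sum_ite_eq', Finset.mem_range]
  set R : Polynomial B := Pδ + Polynomial.C σB * derivative P with hR
  -- `aeval LO R = E · D (aeval LO P) = 0`
  have hRev : Polynomial.aeval LO R = 0 := by
    set Ph : Polynomial (AGerm z₀) := P.map (algebraMap B (AGerm z₀)) with hPh
    have hevP : Polynomial.aeval LO P = Ph.eval LO := by
      rw [Polynomial.aeval_def, hPh, Polynomial.eval_map]
    have hevdP : Polynomial.aeval LO (derivative P) = (derivative Ph).eval LO := by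
      rw [Polynomial.aeval_def, hPh, Polynomial.derivative_map, Polynomial.eval_map]
    have hevPδ : Polynomial.aeval LO Pδ = E * (coeffD Ph).eval LO := by
      have hmap : Pδ.map (algebraMap B (AGerm z₀)) = Polynomial.C E * coeffD Ph := by
        ext j
        rw [Polynomial.coeff_map, hcoefPδ, Polynomial.coeff_C_mul, coeff_coeffD, hPh, Polynomial.coeff_map]
        split_ifs with hj
        · rw [hBval, hδval, hBval]
        · rw [map_zero, hBval, Polynomial.coeff_eq_zero_of_natDegree_lt (by omega)]
          change (0 : AGerm z₀) = E * AGerm.D ((0 : B) : AGerm z₀)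
          rw [ZeroMemClass.coe_zero, AGerm.D_zero, mul_zero]
      rw [Polynomial.aeval_def, ← Polynomial.eval_map, hmap, Polynomial.eval_mul, Polynomial.eval_C]
    have hD0 : AGerm.D (Ph.eval LO) = 0 := by rw [← hevP, hP, AGerm.D_zero]
    calc Polynomial.aeval LO R = E * (coeffD Ph).eval LO + σ * (derivative Ph).eval LO := by
          rw [hR, map_add, map_mul, Polynomial.aeval_C, hBval, hevPδ, hevdP]
      _ = E * ((coeffD Ph).eval LO + (derivative Ph).eval LO * AGerm.D LO) := by
          rw [← hDL]; ring
      _ = 0 := by rw [← AGerm.D_eval, hD0, mul_zero]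
  -- the combination of lower degree
  set Q : Polynomial B := Polynomial.C (P.coeff M) * R - Polynomial.C (δ (P.coeff M)) * P with hQ
  have hQev : Polynomial.aeval LO Q = 0 := by
    rw [hQ, map_sub, map_mul, map_mul, hRev, hP, mul_zero, mul_zero, sub_zero]
  have hcoefR : ∀ j, R.coeff j = (if j < M + 1 then δ (P.coeff j) else 0) +
      σB * (P.coeff (j + 1) * ((j : B) + 1)) := by
    intro j
    rw [hR, Polynomial.coeff_add, hcoefPδ, Polynomial.coeff_C_mul, Polynomial.coeff_derivative]
  have hcoefQ : ∀ j, M ≤ j → Q.coeff j = 0 := by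
    intro j hj
    rw [hQ, Polynomial.coeff_sub, Polynomial.coeff_C_mul, Polynomial.coeff_C_mul, hcoefR]
    rcases eq_or_lt_of_le hj with h | h
    · rw [← h, if_pos (by omega), Polynomial.coeff_eq_zero_of_natDegree_lt (by omega : P.natDegree < M + 1),
        zero_mul, mul_zero, add_zero]
      ring
    · rw [if_neg (by omega), Polynomial.coeff_eq_zero_of_natDegree_lt (by omega : P.natDegree < j + 1),
        Polynomial.coeff_eq_zero_of_natDegree_lt (by omega : P.natDegree < j), zero_mul, mul_zero,
        add_zero, mul_zero, mul_zero, sub_zero]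
  have hQ0 : Q = 0 := by
    by_contra hne
    have hdeg : Q.natDegree < M := by
      rw [Polynomial.natDegree_lt_iff_degree_lt hne, Polynomial.degree_lt_iff_coeff_zero]
      exact hcoefQ
    exact absurd (hmin Q hne hQev) (not_le.2 hdeg)
  -- the `t^{M-1}` coefficient: the trace identity in `B`
  obtain ⟨M', hMM'⟩ : ∃ M', M = M' + 1 := ⟨M - 1, by omega⟩
  have hstar : P.coeff M * (δ (P.coeff M') + σB * (P.coeff M * ((M' : B) + 1))) -
      δ (P.coeff M) * P.coeff M' = 0 := by
    have h := hcoefQ M' |> fun _ => (rfl : Q.coeff M' = Q.coeff M')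
    have hQM' : Q.coeff M' = 0 := by rw [hQ0, Polynomial.coeff_zero]
    rw [hQ, Polynomial.coeff_sub, Polynomial.coeff_C_mul, Polynomial.coeff_C_mul, hcoefR,
      if_pos (by omega), ← hMM'] at hQM'
    exact hQM'
  -- representations of the two coefficients
  obtain ⟨a, b, hab⟩ := hrepr _ (P.coeff M).2
  obtain ⟨e, f, hef⟩ := hrepr _ (P.coeff M').2
  have hpMan : AnalyticAt ℂ (fun z => a.eval z + b.eval z * S z) z₀ :=
    (analyticAt_polynomial_eval a z₀).add ((analyticAt_polynomial_eval b z₀).mul hSan)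
  have hpM'an : AnalyticAt ℂ (fun z => e.eval z + f.eval z * S z) z₀ :=
    (analyticAt_polynomial_eval e z₀).add ((analyticAt_polynomial_eval f z₀).mul hSan)
  have hpMmk : ((P.coeff M : B) : AGerm z₀) = AGerm.mk z₀ hpMan := by
    rw [hab, hzO, aeval_zGerm, aeval_zGerm, hSO, ← AGerm.mk_mul, ← AGerm.mk_add]
  have hpM'mk : ((P.coeff M' : B) : AGerm z₀) = AGerm.mk z₀ hpM'an := by
    rw [hef, hzO, aeval_zGerm, aeval_zGerm, hSO, ← AGerm.mk_mul, ← AGerm.mk_add]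
  have hEmk : E = AGerm.mk z₀ (analyticAt_polynomial_eval (C 2 * q₂ * D) z₀) := by
    rw [hE, hzO, aeval_zGerm]
  have h2Wmk : Polynomial.aeval zO (C 2 * W) = AGerm.mk z₀ (analyticAt_polynomial_eval (C 2 * W) z₀) := by
    rw [hzO, aeval_zGerm]
  have hMmk : ((M' : AGerm z₀) + 1) = AGerm.mk z₀ (analyticAt_const : AnalyticAt ℂ (fun _ : ℂ => ((M' : ℂ) + 1)) z₀) := by
    rw [AGerm.mk_const, map_add, map_natCast, map_one]
  refine ⟨a, b, e, f, M, hM1, ?_, ?_⟩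
  · -- `p_M ≠ 0`
    intro h0
    apply hpM
    have h1 : ((P.coeff M : B) : AGerm z₀) = 0 := by rw [hpMmk]; exact (AGerm.mk_eq_zero_iff _).2 h0
    exact_mod_cast h1
  · -- the identity as a function identity near `z₀`
    have hval0 := congrArg (fun x : B => (x : AGerm z₀)) hstar
    have hval : ((P.coeff M : B) : AGerm z₀) * (E * AGerm.D ((P.coeff M' : B) : AGerm z₀) +
        σ * (((P.coeff M : B) : AGerm z₀) * ((M' : AGerm z₀) + 1))) -
      E * AGerm.D ((P.coeff M : B) : AGerm z₀) * ((P.coeff M' : B) : AGerm z₀) = 0 := by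
      have h1 : ((δ (P.coeff M') : B) : AGerm z₀) = E * AGerm.D ((P.coeff M' : B) : AGerm z₀) := hδval _
      have h2 : ((δ (P.coeff M) : B) : AGerm z₀) = E * AGerm.D ((P.coeff M : B) : AGerm z₀) := hδval _
      have h3 : ((σB : B) : AGerm z₀) = σ := rfl
      push_cast [h1, h2, h3] at hval0
      linear_combination hval0
    rw [hpMmk, hpM'mk, AGerm.D_mk, AGerm.D_mk, hEmk, hσ, h2Wmk, hSO, hMmk] at hval
    simp only [← AGerm.mk_mul, ← AGerm.mk_add, ← AGerm.mk_sub] at hval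
    rw [AGerm.mk_eq_zero_iff] at hval
    rw [hMM']
    filter_upwards [hval] with z hz
    simp only [Pi.sub_apply, Pi.mul_apply, Pi.add_apply, Pi.zero_apply, Polynomial.eval_mul,
      Polynomial.eval_C] at hz
    push_cast
    linear_combination hz

end Relations

end Summit.Schanuel.Schanuel.Theorems
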